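import Mathlib
import Literature.AlgebraicGeometry.HodgeTheory.InvariantClassesFromTotalSpace
import HarnessLib

/-!
# InvariantClassesFromTotalSpaceProper

Topic `Literature/AlgebraicGeometry/HodgeTheory`. Named literature fact(s) relocated by the gate from `Summits/HodgeConjecture/HodgeConjecture/Theorems/Ring2HypothesesFlatSectionsOfPartieFixe.lean`
(accept-time relocation of `[cite]`d propositions written inline in a Summits proposal; human ruling 2026-08-15).
Sources: DeligneHodgeII1971.

* `Literature.AlgebraicGeometry.HodgeTheory.deligne1971_invariantClass_fromTotalSpace_proper`
-/

namespace Literature.AlgebraicGeometry.HodgeTheory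

open CategoryTheory AlgebraicGeometry Topology Filter
open Literature.AlgebraicGeometry Literature.AlgebraicGeometry.Motives Literature.AlgebraicGeometry.HodgeTheory

/-- **Invariant classes come from the total space, for PROPER smooth families** (Deligne, *Théorie de Hodge II*,
Théorème 4.1.1 (i); NAMED FACT), `ℂ`-coefficients, pointwise, on the real carriers of `HodgeTheory/HodgeLocus` — the
sentence of the tree's `deligne1968_invariantClass_fromTotalSpace` (Voisin II Thm. 4.18, where `f` is PROJECTIVE through
the clause `IsQuasiProjectiveOver 𝒳`) WITHOUT the quasi-projectivity of the total space. Printed: "Théorème (4.1.1). —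
Soient `S` un schéma lisse séparé, et `f : X → S` un morphisme propre et lisse. (i) En cohomologie rationnelle, la suite
spectrale de Leray `E₂^{pq} = Hᵖ(S, R^q f_* ℚ) ⇒ H^{p+q}(X, ℚ)` dégénère (`E₂ = E_∞`)" (schéma = schéma de type fini sur
`ℂ`, faisceau sur `S` = faisceau sur `S^an`, loc. cit. 3.2; (i) is proved for `f` projective in [Deligne 1968] and in
general on p. 42, "Prouvons (i) dans le cas général", from (ii) applied to `X ×_S X`). Degeneration at `E₂` makes the
edge homomorphism `Hᵏ(X(ℂ); ℚ) → E₂^{0,k} = Γ(S(ℂ), Rᵏ f_* ℚ)` surjective, hence also after `⊗ ℂ`: every global section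
of `Rᵏ f_* ℂ` is the family of restrictions of ONE class of the total space. Rendered, exactly as the 1968 fact: for
`f : 𝒳 ⟶ S` smooth of relative dimension `n` and proper with smooth projective fibres (`IsSmoothProjectiveFamily f n`)
over a smooth quasi-projective `S` (in particular "lisse séparé de type fini"), every value `σ(s₀)` of a continuous
section `σ` of `FiberClass.pt : FiberClass f k → S(ℂ)` (a global section of `Rᵏ f_* ℂ`) is the restriction of a class of
the total space: `σ s₀ = globalSection f k β s₀` for some `β ∈ Hᵏ(𝒳(ℂ); ℂ)` (the pointwise form; the global form — one
`β` for all `s` over a connected base — follows from the identity principle for continuous sections of the local system,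
as for the 1968 fact). NO hypothesis on the total space `𝒳` beyond `IsSmoothProjectiveFamily`: this is what distinguishes
(i) from the tree's projective statements `deligne1968_invariantClass_fromTotalSpace[_holds]`,
`Motives.Voisin2003_invariantCycles`, `deligne_globalInvariantCycles` (the last through an immersion `𝒳 ↪ X̄` onto a
Zariski-dense subscheme of a projective `X̄`). Consumer: the flat-section form of Grothendieck's variational Hodge
statement for smooth proper families whose total space is not quasi-projective (Hodge summit, Ring 2, row b04).
[cite: DeligneHodgeII1971, Théorème 4.1.1 (i) (p. 40), proof of the general case p. 42, conventions 3.2 (p. 34)]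
[file AlgebraicGeometry/HodgeTheory/InvariantClassesFromTotalSpaceProper] -/
def deligne1971_invariantClass_fromTotalSpace_proper : Prop :=
  ∀ (𝒳 S : SchemeOver ℂ) (f : 𝒳 ⟶ S) (n : ℕ),
    IsSmoothProjectiveFamily f n → IsQuasiProjectiveOver S → AlgebraicGeometry.Smooth S.hom →
    ∀ (k : ℕ) (σ : ComplexPoints S → FiberClass f k),
      Continuous σ → (∀ s, (σ s).pt = s) →
        ∀ s₀ : ComplexPoints S, ∃ β : complexBetti 𝒳 k, σ s₀ = globalSection f k β s₀

end Literature.AlgebraicGeometry.HodgeTheory
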